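import Summits.FinalStateConjecture.FinalStateConjecture.Theorems.PhotonSphereChannelsFiniteSpeed

/-!
# Route PhotonSphereChannels — energy conservation for compactly supported data

Fifth file of the energy–flux calculus for `C²` solutions of `u_tt − u_xx + V u = 0`, `V ≥ 0`
differentiable (`PhotonSphereChannelsEnergyIdentity`, `…EnergyInequalities`, `…ExteriorEnergy`,
`…FiniteSpeed`).  Outside the light cone of the data not only `u` but all its first partials
vanish (`eq_zero_right_of_data`, `eq_zero_left_of_data`: interior points have `u ≡ 0` nearby,
boundary points of the cone follow by continuity of the partials), so the momentum flux
`m = 2 u_t u_x` through far-away vertical lines vanishes and the fixed-ends energy identity gives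
**conservation of the total energy for compactly supported data**:
`∫_{a−T}^{b+T} e(t, ·) = ∫_a^b e(0, ·)` for `|t| ≤ T` (`integral_energy_eq_initial`), the
`lintegral` form over the whole line (`lintegral_energy_eq_initial`), and the curried form in the
vocabulary of the route decl `BlindnessInsidePhotonSphere` (`curried_lintegral_energy_eq_initial`:
its `E0 = ∫⁻ (e ψ 0)` equals `ofReal (∫_{x_e}^{x_c} e ψ 0)`, is finite, and `∫⁻ (e ψ t) = E0` for
every `t`).  No new definitions; standard material [folklore].
-/

namespace Summit.FinalStateConjecture.FinalStateConjecture.Theorems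

open MeasureTheory Set Filter Topology intervalIntegral

noncomputable section

namespace WaveEnergy

variable {u : ℝ × ℝ → ℝ} {V : ℝ → ℝ}

/-! ### Outside the light cone of the data: vanishing of `u` and its partials; energy conservation -/

/-- The derivative of a function vanishing near a point vanishes there. -/
theorem fderiv_eq_zero_of_eventuallyEq_zero {z : ℝ × ℝ} (h : u =ᶠ[𝓝 z] fun _ => 0) :
    fderiv ℝ u z = 0 := by
  rw [h.fderiv_eq]
  simp

/-- **Right of the light cone.** If the data vanish on `[c, ∞)` at time `0`, then at every point
with `c + |τ| ≤ y` the solution AND all its first partials vanish (interior points: `u ≡ 0`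
nearby; boundary points of the cone: by continuity of the partials). -/
theorem eq_zero_right_of_data (hu : ContDiff ℝ 2 u) (hV : Differentiable ℝ V) (hV0 : ∀ x, 0 ≤ V x)
    (hsol : ∀ z : ℝ × ℝ, fderiv ℝ (fderiv ℝ u) z (1, 0) (1, 0)
      - fderiv ℝ (fderiv ℝ u) z (0, 1) (0, 1) + V z.2 * u z = 0)
    {c : ℝ} (h0 : ∀ y, c ≤ y → u (0, y) = 0) (h1 : ∀ y, c ≤ y → fderiv ℝ u (0, y) (1, 0) = 0)
    {τ y : ℝ} (hy : c + |τ| ≤ y) (v : ℝ × ℝ) :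
    u (τ, y) = 0 ∧ fderiv ℝ u (τ, y) v = 0 := by
  -- vanishing of `u` on the closed region
  have hzero : ∀ τ' y' : ℝ, c + |τ'| ≤ y' → u (τ', y') = 0 := by
    intro τ' y' hy'
    refine eq_zero_of_data_eq_zero hu hV hV0 hsol (a := c) (b := y' + |τ'|) (t₁ := 0)
      (fun x hx => h0 x hx.1) (fun x hx => h1 x hx.1) ?_ ?_
    · simpa using hy'
    · simp
  refine ⟨hzero τ y hy, ?_⟩
  -- vanishing of the partials: first at interior points `(τ, y + ε)`, `ε > 0`
  have hopen : IsOpen {z : ℝ × ℝ | c + |z.1| < z.2} :=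
    isOpen_lt (continuous_const.add (continuous_abs.comp continuous_fst)) continuous_snd
  have hint : ∀ ε : ℝ, 0 < ε → fderiv ℝ u (τ, y + ε) v = 0 := by
    intro ε hε
    have hev : u =ᶠ[𝓝 (τ, y + ε)] fun _ => 0 := by
      filter_upwards [hopen.mem_nhds (show c + |(τ, y + ε).1| < (τ, y + ε).2 by
        simp only; linarith)] with z hz
      exact hzero z.1 z.2 (le_of_lt hz)
    rw [fderiv_eq_zero_of_eventuallyEq_zero hev]
    rfl
  -- then at `ε = 0` by continuity of `ε ↦ ∂u(τ, y + ε)(v)`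
  have hcl : IsClosed {ε : ℝ | fderiv ℝ u (τ, y + ε) v = 0} :=
    isClosed_eq ((continuous_fderiv_apply hu v).comp
      ((Continuous.prodMk_right τ).comp (continuous_const.add continuous_id))) continuous_const
  have hsub := hcl.closure_subset_iff.mpr (fun ε (hε : ε ∈ Ioi (0 : ℝ)) => hint ε hε)
  rw [closure_Ioi] at hsub
  simpa using hsub (mem_Ici.mpr le_rfl)

/-- **Left of the light cone.** If the data vanish on `(−∞, c]` at time `0`, then at every point
with `y ≤ c − |τ|` the solution and all its first partials vanish. -/
theorem eq_zero_left_of_data (hu : ContDiff ℝ 2 u) (hV : Differentiable ℝ V) (hV0 : ∀ x, 0 ≤ V x)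
    (hsol : ∀ z : ℝ × ℝ, fderiv ℝ (fderiv ℝ u) z (1, 0) (1, 0)
      - fderiv ℝ (fderiv ℝ u) z (0, 1) (0, 1) + V z.2 * u z = 0)
    {c : ℝ} (h0 : ∀ y, y ≤ c → u (0, y) = 0) (h1 : ∀ y, y ≤ c → fderiv ℝ u (0, y) (1, 0) = 0)
    {τ y : ℝ} (hy : y ≤ c - |τ|) (v : ℝ × ℝ) :
    u (τ, y) = 0 ∧ fderiv ℝ u (τ, y) v = 0 := by
  have hzero : ∀ τ' y' : ℝ, y' ≤ c - |τ'| → u (τ', y') = 0 := by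
    intro τ' y' hy'
    refine eq_zero_of_data_eq_zero hu hV hV0 hsol (a := y' - |τ'|) (b := c) (t₁ := 0)
      (fun x hx => h0 x hx.2) (fun x hx => h1 x hx.2) ?_ ?_
    · simp
    · simpa using hy'
  refine ⟨hzero τ y hy, ?_⟩
  have hopen : IsOpen {z : ℝ × ℝ | z.2 < c - |z.1|} :=
    isOpen_lt continuous_snd (continuous_const.sub (continuous_abs.comp continuous_fst))
  have hint : ∀ ε : ℝ, 0 < ε → fderiv ℝ u (τ, y - ε) v = 0 := by
    intro ε hε
    have hev : u =ᶠ[𝓝 (τ, y - ε)] fun _ => 0 := by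
      filter_upwards [hopen.mem_nhds (show (τ, y - ε).2 < c - |(τ, y - ε).1| by
        simp only; linarith)] with z hz
      exact hzero z.1 z.2 (le_of_lt hz)
    rw [fderiv_eq_zero_of_eventuallyEq_zero hev]
    rfl
  have hcl : IsClosed {ε : ℝ | fderiv ℝ u (τ, y - ε) v = 0} :=
    isClosed_eq ((continuous_fderiv_apply hu v).comp
      ((Continuous.prodMk_right τ).comp (continuous_const.sub continuous_id))) continuous_const
  have hsub := hcl.closure_subset_iff.mpr (fun ε (hε : ε ∈ Ioi (0 : ℝ)) => hint ε hε)
  rw [closure_Ioi] at hsub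
  simpa using hsub (mem_Ici.mpr le_rfl)

/-- On the unordered interval between `0` and `t`, `|τ| ≤ |t|`. -/
theorem abs_le_abs_of_mem_uIcc_zero {τ t : ℝ} (hτ : τ ∈ uIcc (0 : ℝ) t) : |τ| ≤ |t| := by
  rcases le_or_gt 0 t with ht | ht
  · rw [uIcc_of_le ht] at hτ
    rw [abs_of_nonneg hτ.1, abs_of_nonneg ht]
    exact hτ.2
  · rw [uIcc_of_ge ht.le] at hτ
    rw [abs_of_nonpos hτ.2, abs_of_neg ht]
    linarith [hτ.1]

/-- **Energy conservation for compactly supported data.** If the data of a `C²` solution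
(`V ≥ 0` differentiable) vanish outside `(a, b)` at time `0`, then for every `t` and every
`T ≥ |t|` the energy on `[a − T, b + T]` at time `t` equals the initial energy `∫_a^b e(0, ·)`
(oriented integrals; no hypothesis `a ≤ b`).
(Fixed-ends energy identity; the fluxes `m = 2 u_t u_x` through `x = a − T`, `x = b + T` vanish
outside the light cone.) [folklore] -/
theorem integral_energy_eq_initial (hu : ContDiff ℝ 2 u) (hV : Differentiable ℝ V)
    (hV0 : ∀ x, 0 ≤ V x)
    (hsol : ∀ z : ℝ × ℝ, fderiv ℝ (fderiv ℝ u) z (1, 0) (1, 0)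
      - fderiv ℝ (fderiv ℝ u) z (0, 1) (0, 1) + V z.2 * u z = 0)
    {e : ℝ × ℝ → ℝ}
    (he : ∀ z, e z = (fderiv ℝ u z (1, 0)) ^ 2 + (fderiv ℝ u z (0, 1)) ^ 2 + V z.2 * u z ^ 2)
    {a b : ℝ} (hdata : ∀ y, y ≤ a ∨ b ≤ y → u (0, y) = 0 ∧ fderiv ℝ u (0, y) (1, 0) = 0)
    {t T : ℝ} (hT : |t| ≤ T) :
    (∫ x in (a - T)..(b + T), e (t, x)) = ∫ x in a..b, e (0, x) := by
  have hm : ∀ z : ℝ × ℝ, (fun z => 2 * fderiv ℝ u z (1, 0) * fderiv ℝ u z (0, 1)) z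
      = 2 * fderiv ℝ u z (1, 0) * fderiv ℝ u z (0, 1) := fun z => rfl
  have hR := fun (τ y : ℝ) (hy : b + |τ| ≤ y) (v : ℝ × ℝ) =>
    eq_zero_right_of_data hu hV hV0 hsol (c := b) (fun y hy => (hdata y (Or.inr hy)).1)
      (fun y hy => (hdata y (Or.inr hy)).2) hy v
  have hL := fun (τ y : ℝ) (hy : y ≤ a - |τ|) (v : ℝ × ℝ) =>
    eq_zero_left_of_data hu hV hV0 hsol (c := a) (fun y hy => (hdata y (Or.inl hy)).1)
      (fun y hy => (hdata y (Or.inl hy)).2) hy v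
  -- fixed-ends energy identity on `[a - T, b + T] × [0, t]`
  have key := energy_identity_affine hu hV hsol he hm (a - T) 0 (b + T) 0 0 t
  simp only [zero_mul, add_zero] at key
  have hflux : (∫ τ in (0 : ℝ)..t,
      (2 * fderiv ℝ u (τ, b + T) (1, 0) * fderiv ℝ u (τ, b + T) (0, 1)
        - 2 * fderiv ℝ u (τ, a - T) (1, 0) * fderiv ℝ u (τ, a - T) (0, 1))) = 0 := by
    rw [intervalIntegral.integral_congr (g := fun _ => (0 : ℝ)) (fun τ hτ => ?_)]
    · simp
    · have hτ : |τ| ≤ T := (abs_le_abs_of_mem_uIcc_zero hτ).trans hT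
      have h1 := (hR τ (b + T) (by linarith) (1, 0)).2
      have h2 := (hL τ (a - T) (by linarith) (1, 0)).2
      simp only [h1, h2]
      ring
  rw [hflux] at key
  -- the initial energy on `[a - T, b + T]` is the initial energy on `[a, b]`
  have hT0 : 0 ≤ T := (abs_nonneg t).trans hT
  have hec : Continuous fun y => e (0, y) :=
    (continuous_energyDensity hu hV he).comp (Continuous.prodMk_right 0)
  have hi : ∀ p q : ℝ, IntervalIntegrable (fun y => e (0, y)) volume p q :=
    fun p q => hec.intervalIntegrable p q
  have hout : ∀ y, y ≤ a ∨ b ≤ y → e (0, y) = 0 := by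
    intro y hy
    rcases hy with hy | hy
    · have h := hL 0 y (by simpa using hy)
      rw [he, (h (1, 0)).2, (h (0, 1)).2, (h (1, 0)).1]
      ring
    · have h := hR 0 y (by simpa using hy)
      rw [he, (h (1, 0)).2, (h (0, 1)).2, (h (1, 0)).1]
      ring
  have hleft : (∫ y in (a - T)..a, e (0, y)) = 0 := by
    rw [intervalIntegral.integral_congr (g := fun _ => (0 : ℝ)) (fun y hy => ?_)]
    · simp
    · rw [uIcc_of_le (by linarith)] at hy
      exact hout y (Or.inl hy.2)
  have hright : (∫ y in b..(b + T), e (0, y)) = 0 := by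
    rw [intervalIntegral.integral_congr (g := fun _ => (0 : ℝ)) (fun y hy => ?_)]
    · simp
    · rw [uIcc_of_le (by linarith)] at hy
      exact hout y (Or.inr hy.1)
  have hsplit : (∫ y in (a - T)..(b + T), e (0, y))
      = (∫ y in (a - T)..a, e (0, y)) + ((∫ y in a..b, e (0, y)) + ∫ y in b..(b + T), e (0, y)) := by
    rw [intervalIntegral.integral_add_adjacent_intervals (hi a b) (hi b (b + T)),
      intervalIntegral.integral_add_adjacent_intervals (hi (a - T) a) (hi a (b + T))]
  rw [hsplit, hleft, hright] at key
  linarith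

/-- **The total energy is conserved and finite for compactly supported data** (`lintegral` form):
under the hypotheses of `integral_energy_eq_initial`, for every `t`,
`∫⁻ x, ofReal (e (t, x)) = ofReal (∫_a^b e(0, ·))`. [folklore] -/
theorem lintegral_energy_eq_initial (hu : ContDiff ℝ 2 u) (hV : Differentiable ℝ V)
    (hV0 : ∀ x, 0 ≤ V x)
    (hsol : ∀ z : ℝ × ℝ, fderiv ℝ (fderiv ℝ u) z (1, 0) (1, 0)
      - fderiv ℝ (fderiv ℝ u) z (0, 1) (0, 1) + V z.2 * u z = 0)
    {e : ℝ × ℝ → ℝ}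
    (he : ∀ z, e z = (fderiv ℝ u z (1, 0)) ^ 2 + (fderiv ℝ u z (0, 1)) ^ 2 + V z.2 * u z ^ 2)
    {a b : ℝ} (hab : a ≤ b)
    (hdata : ∀ y, y ≤ a ∨ b ≤ y → u (0, y) = 0 ∧ fderiv ℝ u (0, y) (1, 0) = 0) (t : ℝ) :
    ∫⁻ x, ENNReal.ofReal (e (t, x)) = ENNReal.ofReal (∫ x in a..b, e (0, x)) := by
  have hR := fun (τ y : ℝ) (hy : b + |τ| ≤ y) (v : ℝ × ℝ) =>
    eq_zero_right_of_data hu hV hV0 hsol (c := b) (fun y hy => (hdata y (Or.inr hy)).1)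
      (fun y hy => (hdata y (Or.inr hy)).2) hy v
  have hL := fun (τ y : ℝ) (hy : y ≤ a - |τ|) (v : ℝ × ℝ) =>
    eq_zero_left_of_data hu hV hV0 hsol (c := a) (fun y hy => (hdata y (Or.inl hy)).1)
      (fun y hy => (hdata y (Or.inl hy)).2) hy v
  -- outside `[a - |t| - 1, b + |t|]` the integrand vanishes
  have hout : ∀ x, x ∉ Ioc (a - |t| - 1) (b + |t|) → ENNReal.ofReal (e (t, x)) = 0 := by
    intro x hx
    rw [mem_Ioc, not_and_or, not_lt, not_le] at hx
    rcases hx with hx | hx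
    · have h := hL t x (by linarith)
      rw [he, (h (1, 0)).2, (h (0, 1)).2, (h (1, 0)).1]
      simp
    · have h := hR t x (by linarith)
      rw [he, (h (1, 0)).2, (h (0, 1)).2, (h (1, 0)).1]
      simp
  have hec : Continuous fun y => e (t, y) :=
    (continuous_energyDensity hu hV he).comp (Continuous.prodMk_right t)
  rw [← lintegral_add_compl (fun x => ENNReal.ofReal (e (t, x))) measurableSet_Ioc,
    setLIntegral_congr_fun measurableSet_Ioc.compl (fun x hx => hout x hx), lintegral_zero,
    add_zero, lintegral_Ioc_eq_ofReal_intervalIntegral hec (fun x => energyDensity_nonneg hV0 he _)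
      (by linarith [abs_nonneg t]),
    ← integral_energy_eq_initial hu hV hV0 hsol he hdata (t := t) (T := |t| + 1) (by linarith)]
  congr 1
  have e1 : a - |t| - 1 = a - (|t| + 1) := by ring
  have e2 : b + |t| = b + (|t| + 1) - 1 := by ring
  rw [e1]
  -- `∫_{a-(|t|+1)}^{b+|t|} = ∫_{a-(|t|+1)}^{b+(|t|+1)}` since the integrand vanishes on the gap
  have hi : ∀ p q : ℝ, IntervalIntegrable (fun y => e (t, y)) volume p q :=
    fun p q => hec.intervalIntegrable p q
  have hgap : (∫ y in (b + |t|)..(b + (|t| + 1)), e (t, y)) = 0 := by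
    rw [intervalIntegral.integral_congr (g := fun _ => (0 : ℝ)) (fun y hy => ?_)]
    · simp
    · rw [uIcc_of_le (by linarith)] at hy
      have h := hR t y (by linarith [hy.1])
      rw [he, (h (1, 0)).2, (h (0, 1)).2, (h (1, 0)).1]
      ring
  rw [← intervalIntegral.integral_add_adjacent_intervals (hi (a - (|t| + 1)) (b + |t|))
    (hi (b + |t|) (b + (|t| + 1))), hgap, add_zero]

/-- **Total energy of compactly supported data is conserved and finite (curried form).** For a
`C²` solution `ψ : ℝ → ℝ → ℝ` of `ψ_tt − ψ_xx + V(x) ψ = 0` (`iteratedDeriv 2` of slices; `V ≥ 0`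
differentiable) whose data at `t = 0` vanish outside `(xe, xc)`, `xe ≤ xc` — the data hypothesis
of `BlindnessInsidePhotonSphere` — the total energy at every time equals
`ofReal (∫_{xe}^{xc} (ψ_t² + ψ_x² + Vψ²)(0, ·))`; in particular the item's `E0` is finite and
`∫⁻ (e ψ t) = E0` for all `t`. [folklore] -/
theorem curried_lintegral_energy_eq_initial {V : ℝ → ℝ} (hV : Differentiable ℝ V)
    (hV0 : ∀ x, 0 ≤ V x) {ψ : ℝ → ℝ → ℝ} (hψ : ContDiff ℝ 2 (Function.uncurry ψ))
    (hsol : ∀ t x : ℝ, iteratedDeriv 2 (fun τ => ψ τ x) t - iteratedDeriv 2 (ψ t) x + V x * ψ t x = 0)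
    {xe xc : ℝ} (hxe : xe ≤ xc)
    (hdata : ∀ x, x ≤ xe ∨ xc ≤ x → ψ 0 x = 0 ∧ deriv (fun τ => ψ τ x) 0 = 0) (t : ℝ) :
    ∫⁻ x, ENNReal.ofReal (deriv (fun τ => ψ τ x) t ^ 2 + deriv (ψ t) x ^ 2 + V x * ψ t x ^ 2)
      = ENNReal.ofReal (∫ x in xe..xc,
          (deriv (fun τ => ψ τ x) 0 ^ 2 + deriv (ψ 0) x ^ 2 + V x * ψ 0 x ^ 2)) := by
  have hsol' : ∀ z : ℝ × ℝ, fderiv ℝ (fderiv ℝ (Function.uncurry ψ)) z (1, 0) (1, 0)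
      - fderiv ℝ (fderiv ℝ (Function.uncurry ψ)) z (0, 1) (0, 1)
      + V z.2 * Function.uncurry ψ z = 0 := by
    rintro ⟨t, x⟩
    rw [← iteratedDeriv_two_slice_fst_eq hψ, ← iteratedDeriv_two_slice_snd_eq hψ]
    exact hsol t x
  have he : ∀ z : ℝ × ℝ, (fun z : ℝ × ℝ =>
      deriv (fun τ => ψ τ z.2) z.1 ^ 2 + deriv (ψ z.1) z.2 ^ 2 + V z.2 * ψ z.1 z.2 ^ 2) z
      = (fderiv ℝ (Function.uncurry ψ) z (1, 0)) ^ 2 + (fderiv ℝ (Function.uncurry ψ) z (0, 1)) ^ 2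
        + V z.2 * Function.uncurry ψ z ^ 2 := by
    rintro ⟨t, x⟩
    simp only [Function.uncurry_apply_pair]
    rw [deriv_slice_fst_eq hψ, deriv_slice_snd_eq hψ]
  have hdata' : ∀ y, y ≤ xe ∨ xc ≤ y → Function.uncurry ψ (0, y) = 0
      ∧ fderiv ℝ (Function.uncurry ψ) (0, y) (1, 0) = 0 := by
    intro y hy
    refine ⟨(hdata y hy).1, ?_⟩
    rw [← deriv_slice_fst_eq hψ]
    exact (hdata y hy).2
  exact lintegral_energy_eq_initial hψ hV hV0 hsol' he hxe hdata' t

end WaveEnergy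

end

end Summit.FinalStateConjecture.FinalStateConjecture.Theorems
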